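import Summits.BirchSwinnertonDyer.BirchSwinnertonDyer.Theorems.KatoDescentTamePotSupersingularTameFineSelmerOrdinaryAnchor
import Summits.BirchSwinnertonDyer.BirchSwinnertonDyer.Theorems.KatoDescentPotSupersingularWildFineSelmerCongruenceFact
import Summits.BirchSwinnertonDyer.BirchSwinnertonDyer.Theorems.KatoDescentTamePotSupersingularTameUpperNonsurjNodes
import Summits.BirchSwinnertonDyer.Rank1Residual.Additive.PotSupersingularClasses
import HarnessLib

/-!
# Route `KatoDescentTamePotSupersingular` (rung K8, sub-rung B4 (t′), cell `bsd-potss`): the ♯ ROWS of the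
# Conj-A crux `TameFineSelmerCoatesSujatha` (item stmt-BirchSwinnertonDyer-19413) from PER-ROW CONGRUENT
# CERTIFICATES, and the whole U₀-ns child `TameUpperNonsurjTower` (item 19202, child of U₀ = 19982) from the
# Heegner road (♭ rows) + congruent anchors (♯ rows) — ROUTE-FREE (imports no `Theses.*`; a
# `--supports … --as helper` file; seat `bsd-potss-k8t-c4` g4; nothing booked, BSD not proved by any of this)

CONTEXT. The k9-c4 seat (g3) built the CONGRUENCE ROAD for the Conj-A cruxes: (A) at `(E,p)` depends only on
the `G_ℚ`-module `E[p]` (Lim–Sujatha, J. Number Theory 187 (2018) §3 Prop. 3.2 — the registered fact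
`LimSujatha2018.prop32_fineSelmerDual_moduleFinite_iff_of_torsionIso`, p445851, `p ≠ 2`), so each row is
discharged by ONE congruent elliptic curve `W′` (`O6.ModPCongruent W′ W p`) carrying (A) outright or finite
`p`-torsion in its classical Selmer group over every cyclotomic `ℤ_p`-tower (their unconditional
`WildFineSelmerOrdinaryAnchor.conjA_rat_of_finite_selmerInfty_pTorsion`), and filed the (t′) row form and the
crux body from mixed certificates (`TameFineSelmerOrdinaryAnchor.*`, idle-prover courtesy to this seat). This
seat's g3 RE-HOMED the Heegner road route-free (`TameUpperHeegnerRoad.upperNonsurjTower_of_lower_of_rankOne_of_fineSelmerSharp`,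
p437915, TARGET R100a): on the ♭ rows U₀-ns(t′) is dominated by L₀ ∧ TameRankOne ∧ print, and only the ♯ rows
(`p ∣ ∏c_ℓ` or no Manin-clean parametrisation at level `N_E`; 90 / 292 census pairs) carry (A). This file
joins the two:

* `§1` `missingUpperBoundAt_tame_of_congruentConjA` — row form with a Conj-A anchor in (t′) currency (the
  ordinary-type-anchor form is k9-c4's `TameFineSelmerOrdinaryAnchor.missingUpperBoundAt_addv_…`);
* `§2` **`tameFineSelmerSharp_of_mixedCertificates`** — the ♯-restricted binder `hCS` of the re-homed Heegner
  road from Lim–Sujatha and ONE mixed certificate per ♯ row (the K9 twin is k9-c4's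
  `WildFineSelmerCongruence.wildFineSelmerSharp_of_congruentCertificates`);
* `§3` **`upperNonsurjTower_of_lower_of_rankOne_of_sharpCertificates`** — the BODY of the U₀-ns child
  `TameUpperNonsurjTower` (item 19202) from the Heegner-road inputs (Gross–Zagier, Kolyvagin, Matar–Nekovář,
  modularity, Bump–Friedberg–Hoffstein), the bodies of items 19191 / 19387 / 19981 (L₀) / 19984 (TameRankOne),
  Lim–Sujatha, and per-♯-row mixed certificates: after the planner's R100 re-cut this is the `closes` term,
  and the load-bearing residue of U₀-ns(t′) is «one congruent anchor on each ♯ row».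

WHERE ANCHORS CAN EXIST (an observation, not an input). A good ORDINARY anchor `W′` has an unramified quotient
of `W′[p]|G_{ℚ_p}`; on a (t′) row with `e < p − 1` (all `p ≥ 11`; `p = 7`, where (t′) forces `e = 4`; `p = 5`
with `e = 3`) the potentially supersingular `W[p]|G_{ℚ_p}` has none (good model over the tame field of
ramification `e < p − 1`, Raynaud's uniqueness), so ordinary-type anchors are available only at `p = 3` and
at `p = 5, e = 6` — where the ♯ census lives (g2: `p = 3`: 129, `p = 5`: 160, `p = 7`: 3 of 292). Kato unit
anchors (o6-r1's (A⋆)) are not so restricted. No census number is an input below. CONDITIONAL (audit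
`proof.conditional`); items 19413 / 19202 / 19982 are NOT closed; BSD is not proved by any of this.

References: [LimSujatha2018] §3 Prop. 3.2 (arXiv:1603.08640 p. 8); [CoatesSujatha2005] Conj. A;
[GreenbergVatsal2000] §2 Prop. (2.8); [Kato2004Asterisque] Thm. 14.5 (3) (p. 236), Prop. 14.16 (2) (p. 244);
[GrossZagier1986]; [Kolyvagin1990]; [MatarNekovar2019] Thm. 0.3; [BumpFriedbergHoffstein1990];
[Miller2011LMS] Def. 1.1.
-/

set_option autoImplicit false
-- sibling precedent (`KatoDescentTamePotSupersingularAssembly.lean`): the directory name repeats the summit name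
set_option linter.dupNamespace false

noncomputable section

open scoped Classical

namespace Summit.BirchSwinnertonDyer.BirchSwinnertonDyer.Theorems.TameFineSelmerCongruence

open WeierstrassCurve Literature.NumberTheory.EllipticCurves
  Literature.NumberTheory.EllipticCurves.ModularForms
  Literature.NumberTheory.EllipticCurves.Rank1Residual
  Literature.NumberTheory.EllipticCurves.Rank1Residual.Typed
  Summit.BirchSwinnertonDyer.Rank1Residual Summit.BirchSwinnertonDyer.Rank1Residual.Additive
  Summit.BirchSwinnertonDyer.Rank1Residual.O6
  Summit.BirchSwinnertonDyer.BirchSwinnertonDyer.Theorems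

/-! ## §1 Row form, (t′) currency, Conj-A anchor -/

/-- **THE CONGRUENCE ROAD on a (t′) row with a Conj-A anchor.** Granted Lim–Sujatha (`hLS`), the
fine-Selmer Kato fact (`hKatoA`, p420034), GZK (`hGZK`) and modularity (`hmod`): on a (t′) row (`p ≠ 2`,
`Addv`, `SubTprime`) of analytic rank `0` with `W[p]` irreducible, ONE elliptic `W′/ℚ` with
`W′[p] ≃ W[p]` `Γ_ℚ`-equivariantly and (A) at `(W′,p)` gives `ord_p #Ш(W) ≤ ord_p #Ш_an(W)` — (A) at
`(W,p)` by the row transfer (`WildFineSelmerCongruenceFact.conjA_of_modPCongruent`), then k9-c4's (t′) row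
theorem with `W` as its own ordinary-free anchor replaced by the direct chain: p420034 at the Conj-A binding
(`WildFineSelmerCongruence.x4UpperOfFineMuZero_conjA`, `ord_p j ≥ 0` from `ClassO5`) and Miller's currency
(`O6.exists_shaAn_le_add_torsion_of_katoCurrency`, torsion killed by irreducibility). Conditional; nothing
booked. [cite: LimSujatha2018, §3 Prop. 3.2]
[cite: Kato2004Asterisque, Thm. 14.5 (3) (p. 236), Prop. 14.16 (2) (p. 244)] [cite: Miller2011LMS, Def. 1.1] -/
theorem missingUpperBoundAt_tame_of_congruentConjA
    (hLS : LimSujatha2018.prop32_fineSelmerDual_moduleFinite_iff_of_torsionIso)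
    (hKatoA :
      Kato2004.rankZero_padicValNat_sha_add_padicValNat_tamagawa_le_of_additive_potGood_of_irreducible_of_fineSelmerDual_fg)
    (hGZK : rank_eq_analyticRank_of_analyticRank_le_one) (hmod : hasEntireLFunction_rat)
    (W : WeierstrassCurve ℚ) [W.IsElliptic] [W.IsGloballyMinimal] (p : ℕ) [Fact p.Prime]
    (hr : W.analyticRank = 0) (hp : p ≠ 2) (hadd : Addv W p) (hT : SubTprime W p)
    (hirr : W.HasIrreducibleModPGaloisRep p)
    (hanchor : ∃ (W' : WeierstrassCurve ℚ) (_ : W'.IsElliptic), ModPCongruent W' W p ∧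
      ∀ (κ : ZpExtension ℚ p), κ.IsCyclotomic →
        ∃ (γ : Field.absoluteGaloisGroup ℚ) (D : W'.FineSelmerDualData κ γ),
          Module.Finite ℤ_[p] (RestrictScalars ℤ_[p] (IwasawaAlgebra p) D.X)) :
    MissingUpperBoundAt W p := by
  obtain ⟨W', hW', hcong, hA'⟩ := hanchor
  haveI := hW'
  have hO5 : ClassO5 W p := ⟨hp, hadd, Or.inr hT⟩
  -- (A) at `(W, p)` by Lim–Sujatha
  have hA : ∀ (κ : ZpExtension ℚ p), κ.IsCyclotomic →
      ∃ (γ : Field.absoluteGaloisGroup ℚ) (D : W.FineSelmerDualData κ γ),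
        Module.Finite ℤ_[p] (RestrictScalars ℤ_[p] (IwasawaAlgebra p) D.X) :=
    WildFineSelmerCongruenceFact.conjA_of_modPCongruent hLS hp hcong hA'
  -- Kato's A161″ conclusion at `W` (p420034 at the Conj-A binding), then Miller's currency
  have hL : W.entireLFunction 1 ≠ 0 := (W.analyticRank_eq_zero_iff_holds (hmod W)).mp hr
  obtain ⟨-, hfin⟩ := hGZK W (by rw [hr]; exact zero_le_one)
  obtain ⟨q₀, hq₀, hle⟩ := WildFineSelmerCongruence.x4UpperOfFineMuZero_conjA hKatoA W p hp hadd.1 hadd.2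
    hO5.padicValRat_j_nonneg hirr (fun κ hκ ↦ hA κ hκ) hL hfin
  have ht0 : padicValNat p W.torsionOrder = 0 := padicValNat_torsionOrder_eq_zero_of_irreducible W p hirr
  obtain ⟨q, hq, hle'⟩ := exists_shaAn_le_add_torsion_of_katoCurrency hGZK hmod W p hr hfin hq₀
    (by rw [ht0, Nat.cast_zero, mul_zero, add_zero]; exact hle)
  refine ⟨q, hq, ?_⟩
  rw [ht0, Nat.cast_zero, add_zero] at hle'
  exact hle'

/-! ## §2 The ♯-restricted Conj-A binder of the re-homed Heegner road from certificates on the ♯ rows -/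

/-- **The `hCS` binder of `TameUpperHeegnerRoad.upperNonsurjTower_of_lower_of_rankOne_of_fineSelmerSharp`
(p437915; = (A) on the non-CM (t′) rows of analytic rank `0` with `W[p]` irreducible, `ρ̄_{E,p}` NOT onto and
`p ∣ ∏c_ℓ` or no Manin-clean parametrisation at level `N_E`) from Lim–Sujatha (`hLS`) and ONE MIXED
CERTIFICATE on each ♯ row** — a congruent `W′` with (A) at `(W′,p)` outright or with finite
`Sel_{p^∞}(W′/ℚ^cyc)[p]` for every cyclotomic datum (k9-c4's `conjA_rat_of_finite_selmerInfty_pTorsion`).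
The (t′) twin of `WildFineSelmerCongruence.wildFineSelmerSharp_of_congruentCertificates`. Conditional; nothing
booked. [cite: LimSujatha2018, §3 Prop. 3.2] [cite: GreenbergVatsal2000, §2 Prop. (2.8)]
[cite: CoatesSujatha2005, Conjecture A] -/
theorem tameFineSelmerSharp_of_mixedCertificates
    (hLS : LimSujatha2018.prop32_fineSelmerDual_moduleFinite_iff_of_torsionIso)
    (hcert : ∀ (W : WeierstrassCurve ℚ) [W.IsElliptic] [W.IsGloballyMinimal] (p : ℕ) [Fact p.Prime],
      W.analyticRank = 0 → p ≠ 2 → Addv W p → SubTprime W p → ¬ W.HasCM →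
      W.HasIrreducibleModPGaloisRep p → ¬ W.HasSurjectiveModNGaloisRep p →
      (p ∣ W.tamagawaProduct ∨ ∀ [NeZero (W.conductorNorm ℤ)]
        (D : ModularParametrizationData W (W.conductorNorm ℤ)), (p : ℤ) ∣ D.c) →
      ∃ (W' : WeierstrassCurve ℚ) (_ : W'.IsElliptic), ModPCongruent W' W p ∧
        ((∀ (κ : ZpExtension ℚ p), κ.IsCyclotomic →
            ∃ (γ : Field.absoluteGaloisGroup ℚ) (D : W'.FineSelmerDualData κ γ),
              Module.Finite ℤ_[p] (RestrictScalars ℤ_[p] (IwasawaAlgebra p) D.X)) ∨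
          ∀ (κ : ZpExtension ℚ p), κ.IsCyclotomic → Set.Finite {s : W'.selmerInfty κ | p • s = 0})) :
    ∀ (W : WeierstrassCurve ℚ) [W.IsElliptic] [W.IsGloballyMinimal] (p : ℕ) [Fact p.Prime],
      W.analyticRank = 0 → p ≠ 2 → Addv W p → SubTprime W p → ¬ W.HasCM →
      W.HasIrreducibleModPGaloisRep p → ¬ W.HasSurjectiveModNGaloisRep p →
      (p ∣ W.tamagawaProduct ∨ ∀ [NeZero (W.conductorNorm ℤ)]
        (D : ModularParametrizationData W (W.conductorNorm ℤ)), (p : ℤ) ∣ D.c) →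
      ∀ (κ : ZpExtension ℚ p), κ.IsCyclotomic →
        ∃ (γ : Field.absoluteGaloisGroup ℚ) (D : W.FineSelmerDualData κ γ),
          Module.Finite ℤ_[p] (RestrictScalars ℤ_[p] (IwasawaAlgebra p) D.X) := by
  intro W _ _ p _ hr hp hadd hT hcm hirr hsp hsharp
  obtain ⟨W', hW', hcong, hA' | hfin'⟩ := hcert W p hr hp hadd hT hcm hirr hsp hsharp
  · haveI := hW'
    exact WildFineSelmerCongruenceFact.conjA_of_modPCongruent hLS hp hcong hA'
  · haveI := hW'
    exact WildFineSelmerCongruenceFact.conjA_of_modPCongruent hLS hp hcong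
      (WildFineSelmerOrdinaryAnchor.conjA_rat_of_finite_selmerInfty_pTorsion W' hfin')

/-! ## §3 The U₀-ns child's BODY from the Heegner road (♭ rows) and congruent anchors (♯ rows) -/

/-- **The BODY of `TameUpperNonsurjTower` (item 19202) from the Heegner road and per-♯-row congruent
certificates.** Hypotheses, in order: the `∀ N W K` schemata of Gross–Zagier (`hGZ`), Kolyvagin (`hKo`),
Matar–Nekovář's irreducible Ш-index bound (`hMN`); modularity as `exists_isNewformOf` (`hnf`);
Bump–Friedberg–Hoffstein (`hBFH`); the body of `KatoTamagawaExactInputs` (item 19191, `hK`); the body of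
`PublishedInputsFineSelmerCM` (item 19387, `hF`); the body of `TameLowerHalfRankZero` (item 19981, `h₂`); the
body of `TameRankOne` (item 19984, `hR`); Lim–Sujatha (`hLS`); and ONE mixed certificate on each ♯ row
(`hcert`). Proof: this seat g3's `TameUpperHeegnerRoad.upperNonsurjTower_of_lower_of_rankOne_of_fineSelmerSharp`
with its `hCS` binder supplied by `§2`. After the planner's R100 re-cut of 19413 to the ♯ rows this is the
term `closes` calls for `h₄a`; the load-bearing residue of U₀-ns(t′) is «one congruent anchor on each ♯ row».
Conditional on every displayed hypothesis; items 19202 / 19413 are NOT closed.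
[cite: LimSujatha2018, §3 Prop. 3.2] [cite: GrossZagier1986] [cite: Kolyvagin1990] [cite: MatarNekovar2019, Thm. 0.3]
[cite: Kato2004Asterisque, Thm. 14.5 (3) (p. 236), Prop. 14.16 (2) (p. 244)] [cite: CoatesSujatha2005, Conjecture A] -/
theorem upperNonsurjTower_of_lower_of_rankOne_of_sharpCertificates
    (hGZ : ∀ (N : ℕ) [NeZero N] (W : WeierstrassCurve ℚ) (K : Type) [Field K] [NumberField K],
      gross_zagier N W K)
    (hKo : ∀ (N : ℕ) [NeZero N] (W : WeierstrassCurve ℚ) (K : Type) [Field K] [NumberField K],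
      kolyvagin N W K)
    (hMN : ∀ (N : ℕ) [NeZero N] (W : WeierstrassCurve ℚ) (K : Type) [Field K] [NumberField K],
      MatarNekovar2019.thm03_padicValNat_card_sha_le_of_irreducible N W K)
    (hnf : exists_isNewformOf) (hBFH : bumpFriedbergHoffstein_exists_heegnerField_split_twist_simpleZero)
    (hK : Kato2004.rankZero_padicValNat_sha_add_padicValNat_tamagawa_le_of_additive_potGood_of_imageContainsSL2 ∧
      rank_eq_analyticRank_of_analyticRank_le_one ∧ WeierstrassCurve.hasEntireLFunction_rat)
    (hF : Kato2004.rankZero_padicValNat_sha_add_padicValNat_tamagawa_le_of_additive_potGood_of_irreducible_of_fineSelmerDual_fg ∧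
      bsdTriple_of_hasCM_of_L_one_ne_zero)
    (h₂ : ∀ (W : WeierstrassCurve ℚ) [W.IsElliptic] [W.IsGloballyMinimal] (p : ℕ) [Fact p.Prime],
      W.analyticRank = 0 → p ≠ 2 → Addv W p → SubTprime W p → MissingLowerBoundAt W p)
    (hR : ∀ (W : WeierstrassCurve ℚ) [W.IsElliptic] [W.IsGloballyMinimal] (p : ℕ) [Fact p.Prime],
      W.analyticRank = 1 → p ≠ 2 → Addv W p → SubTprime W p → MissingPPartAt W p)
    (hLS : LimSujatha2018.prop32_fineSelmerDual_moduleFinite_iff_of_torsionIso)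
    (hcert : ∀ (W : WeierstrassCurve ℚ) [W.IsElliptic] [W.IsGloballyMinimal] (p : ℕ) [Fact p.Prime],
      W.analyticRank = 0 → p ≠ 2 → Addv W p → SubTprime W p → ¬ W.HasCM →
      W.HasIrreducibleModPGaloisRep p → ¬ W.HasSurjectiveModNGaloisRep p →
      (p ∣ W.tamagawaProduct ∨ ∀ [NeZero (W.conductorNorm ℤ)]
        (D : ModularParametrizationData W (W.conductorNorm ℤ)), (p : ℤ) ∣ D.c) →
      ∃ (W' : WeierstrassCurve ℚ) (_ : W'.IsElliptic), ModPCongruent W' W p ∧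
        ((∀ (κ : ZpExtension ℚ p), κ.IsCyclotomic →
            ∃ (γ : Field.absoluteGaloisGroup ℚ) (D : W'.FineSelmerDualData κ γ),
              Module.Finite ℤ_[p] (RestrictScalars ℤ_[p] (IwasawaAlgebra p) D.X)) ∨
          ∀ (κ : ZpExtension ℚ p), κ.IsCyclotomic → Set.Finite {s : W'.selmerInfty κ | p • s = 0})) :
    ∀ (W : WeierstrassCurve ℚ) [W.IsElliptic] [W.IsGloballyMinimal] (p : ℕ) [Fact p.Prime],
      W.analyticRank = 0 → p ≠ 2 → Addv W p → SubTprime W p → W.HasIrreducibleModPGaloisRep p →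
      ¬ (∀ n : ℕ, W.HasSurjectiveModNGaloisRep (p ^ n : ℕ)) → MissingUpperBoundAt W p :=
  TameUpperHeegnerRoad.upperNonsurjTower_of_lower_of_rankOne_of_fineSelmerSharp hGZ hKo hMN hnf hBFH hK hF
    h₂ hR (tameFineSelmerSharp_of_mixedCertificates hLS hcert)

end Summit.BirchSwinnertonDyer.BirchSwinnertonDyer.Theorems.TameFineSelmerCongruence

end
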